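import Literature.AlgebraicGeometry.Morphisms.ProperCoherentCohomologyFiniteOfIntegral
import Literature.AlgebraicGeometry.Morphisms.CohOfVectorBundle
import Literature.AlgebraicGeometry.Motives.CechCoverProperFinite
import Literature.AlgebraicGeometry.Motives.CechCoverOrderedSections
import Literature.AlgebraicGeometry.Modules.CechOrderedComputesCohomology
import Literature.Algebra.Homology.HomologyAddEquivTransfer
import HarnessLib

/-!
# Finiteness of coherent cohomology on a proper scheme over a field — the named fact
# `GortzWedhorn2023_cohomology_proper_coherent_finite` HOLDS (Görtz–Wedhorn II, Cor. 23.18)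

Görtz–Wedhorn II, Cor. 23.18 (field case): for `X → Spec k` proper and `𝓕` coherent, every
`Hⁿ(X, 𝓕) = Hom_{D(Mod 𝒪_X)}(Q 𝒪_X[0], (Q 𝓕[0])⟦n⟧)` is a finite-dimensional `k`-vector space.  This
file proves it, assembling the tree's pieces of the printed proof (Thm. 23.17 by noetherian induction
and dévissage; Chow's lemma; Serre's theorems; the Čech comparison):

1. `Morphisms/ProperCoherentCohomologyFiniteOfIntegral` (`…_of_integral_ext`): by the dévissage of
   Görtz–Wedhorn I, Lemma 12.63 on the exact class `𝒦_Ext` and the closed-immersion transfer, it suffices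
   to show `Extⁿ_{𝒪_V}(𝒪_V, 𝒪_V)` finite over `k` for `V → Spec k` proper and INTEGRAL;
2. degree `0`: `Ext⁰(𝒪_V, 𝒪_V) ↪ Γ(V, 𝒪_V)` is finite (`module_finite_ext_unit_zero`, formal functions);
3. degree `n + 1`: choose a finite cover `𝔚` of `V` by non-empty affine opens (a Čech cover of
   `(V → Spec k, div 1)`, `Motives/CartierDivisorCech`); by the ORDERED Leray theorem of
   `Modules/CechOrderedComputesCohomology` (seat core-qb: Görtz–Wedhorn II Thm. 22.9),
   `Extⁿ⁺¹(𝒪_V, 𝒪_V) ≃+ Hⁿ⁺¹(Hom(𝒪_V, Č•_ord(𝔚, 𝒪_V)))`; by `Motives/CechCoverOrderedSections` the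
   cochains of the latter are the ordered Čech cochains of the family `s ↦ Γ(W_s, 𝒪_V) ⊆ K(V)`
   (`CartierDivisor.CechCover.complex`), compatibly with the differentials, so
   `Algebra/Homology/HomologyAddEquivTransfer` identifies the homologies; the latter homology is finitely
   generated over `Γ(Spec k, 𝒪) ≅ k` (`Motives/CechCoverProperFinite`: the rank-one dévissage
   `FracFamily.moduleFinite_homology_of_isCoherent` with the Chow families `chowFamilies`); and the
   composite bijection is `k`-semilinear for `k ≅ Γ(Spec k, 𝒪)` because `c ∈ k` acts on `Ext` by
   post-composition with `c • 𝟙` (`Ext.smul_eq_comp_mk₀`), which the ordered Leray isomorphism carries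
   to `Č•_ord(𝔚, c • 𝟙)` (`extUnitAddEquivHomologySucc_naturality`), i.e. to multiplication by the
   rational function of `c` on cochains (`homTopAddEquiv_map`, `toK_smul_top`).

* `module_finite_ext_unit_unit_succ_of_isIntegral`, `module_finite_ext_unit_unit_of_isIntegral` — step 3
  and steps 2+3: **`Extⁿ(𝒪_V, 𝒪_V)` is finite over `k` for `V → Spec k` proper, `V` integral**;
* **`GortzWedhorn2023_cohomology_proper_coherent_finite_holds`** — THE NAMED FACT HOLDS.

Everything is proved; no named facts; net named-fact debt `−1`.

## References

* U. Görtz, T. Wedhorn, *Algebraic Geometry II: Cohomology of Schemes* (2023), Thm. 22.9 (p. 332),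
  Thm. 23.17 with its proof and Cor. 23.18 (pp. 424–425). [GortzWedhorn2023]
* U. Görtz, T. Wedhorn, *Algebraic Geometry I: Schemes*, 2nd ed. (2020), Lemma 12.63 (p. 436),
  Prop. 3.29 (p. 102). [GortzWedhorn2020]
* R. Hartshorne, *Algebraic Geometry*, GTM 52 (1977), III Thm. 4.5, III Lemma 2.10, III Thm. 5.2.
  [Hartshorne1977]
-/

noncomputable section

-- `TopCat.Presheaf`/`Scheme.Modules` are not reducible (as in Mathlib's `AlgebraicGeometry/Modules/Sheaf.lean`).
set_option backward.isDefEq.respectTransparency false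

open CategoryTheory CategoryTheory.Limits CategoryTheory.Abelian AlgebraicGeometry TopologicalSpace Opposite

namespace Literature.AlgebraicGeometry.Morphisms

open Literature.AlgebraicGeometry.Modules Literature.AlgebraicGeometry.Motives
  Literature.Algebra.Homology

section Integral

variable (k : Type) [Field k] (V : Over (Spec (CommRingCat.of k))) [IsProper V.hom] [IsIntegral V.left]

omit [IsProper V.hom] in
/-- The faces `⋂_{i ∈ s} W_i` of a Čech cover are the opens `W_s` of `Motives/CartierDivisorCech`.
[cite: GortzWedhorn2023, Def. 21.64 (p. 258)] -/
private lemma faceSet_eq_opens {D : CartierDivisor V.left} (𝔚 : CartierDivisor.CechCover V.hom ⊤ D)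
    (s : Finset (Fin (𝔚.r + 1))) : CechOrd.faceSet 𝔚.W s = 𝔚.opens s := by
  apply le_antisymm
  · refine le_inf ?_ (Finset.le_inf fun a ha => CechOrd.faceSet_le ha)
    rw [Scheme.Hom.preimage_top]; exact le_top
  · exact le_iInf₂ fun i hi => 𝔚.opens_le_W hi

/-- **Step 3: `Extⁿ⁺¹(𝒪_V, 𝒪_V)` is finite over `k` for `V → Spec k` proper with `V` integral** (ordered
Leray + the function-field Čech model + the rank-one dévissage with Chow families; `k`-semilinearity
through the naturality of the Leray isomorphism). [cite: GortzWedhorn2023, Thm. 23.17 with proof and Cor. 23.18 (pp. 424–425); Thm. 22.9 (p. 332)] -/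
theorem module_finite_ext_unit_unit_succ_of_isIntegral (n : ℕ) :
    Module.Finite k (Ext.{1} (unitModule V.left) (unitModule V.left) (n + 1)) := by
  classical
  -- a Čech cover of `V` adapted to the unit divisor
  obtain ⟨𝔚⟩ := CartierDivisor.CechCover.nonempty_top (pr := V.hom)
    (CartierDivisor.principal (X := V.left) 1 one_ne_zero)
  letI := CartierDivisor.baseAlgebra V.hom ⊤ 𝔚.genericPoint_mem
  -- hypotheses of the ordered Leray theorem
  have hU : ∀ s : Finset (Fin (𝔚.r + 1)), s.Nonempty → IsAffineOpen (CechOrd.faceSet 𝔚.W s) := by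
    intro s hs
    rw [faceSet_eq_opens k V 𝔚 s]
    exact 𝔚.isAffineOpen_opens (isAffineOpen_top _) hs
  have hcov : ⨆ i, 𝔚.W i = ⊤ := by rw [𝔚.iSup_W, Scheme.Hom.preimage_top]
  have hM : IsAffineLocalizing (unitModule V.left) := IsAffineLocalizing.unit
  -- the two models of the ordered Čech complex and their degreewise identification
  let K : CochainComplex AddCommGrpCat.{1} ℕ := CechOrd.homComplex 𝔚.W (unitModule V.left)
  let L : CochainComplex (ModuleCat.{0} Γ(Spec (CommRingCat.of k), ⊤)) ℤ := 𝔚.complex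
  let e : ∀ m : ℕ, (K.X m : Type 1) ≃+ (L.X (m : ℤ) : Type) := fun m =>
    (CechOrd.homTopAddEquiv 𝔚.W (unitModule V.left) m).trans (𝔚.sectionsAddEquiv m)
  have he : ∀ (m : ℕ) (x : K.X m),
      e (m + 1) ((K.d m (m + 1)).hom x) = (L.d (m : ℤ) ((m + 1 : ℕ) : ℤ)).hom (e m x) := by
    intro m x
    change 𝔚.sectionsAddEquiv (m + 1) (CechOrd.homTopAddEquiv 𝔚.W (unitModule V.left) (m + 1)
      (((CechOrd.homComplex 𝔚.W (unitModule V.left)).d m (m + 1)).hom x)) = _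
    rw [CechOrd.homTopAddEquiv_d, 𝔚.sectionsAddEquiv_d]
    have hd : 𝔚.complex.d (m : ℤ) ((m : ℤ) + 1) =
        ModuleCat.ofHom (OrderedCech.d 𝔚.sectionsOn 𝔚.sectionsOn_mono (m : ℤ)) :=
      OrderedCech.complex_d 𝔚.sectionsOn 𝔚.sectionsOn_mono m
    change _ = (𝔚.complex.d (m : ℤ) ((m : ℤ) + 1)).hom _
    rw [hd]
    rfl
  -- `Ext ≃+ Hⁿ⁺¹(K) ≃+ Hⁿ⁺¹(L)`
  let E := CechOrd.extUnitAddEquivHomologySucc 𝔚.W (unitModule V.left) hU hcov hM n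
  let T := HomologyTransfer.homologyAddEquiv e he n
  let f : Ext.{1} (unitModule V.left) (unitModule V.left) (n + 1) ≃+ (L.homology ((n + 1 : ℕ) : ℤ) : Type) :=
    E.trans T
  -- finiteness of `Hⁿ⁺¹(L)` over `Γ(Spec k, 𝒪)`
  haveI : Module.Finite Γ(Spec (CommRingCat.of k), ⊤) (L.homology ((n + 1 : ℕ) : ℤ)) :=
    module_finite_homology_structureSheaf k V 𝔚 _
  -- semilinearity for `σ : k ≅ Γ(Spec k, 𝒪)`
  let σ : k →+* Γ(Spec (CommRingCat.of k), ⊤) := (Scheme.ΓSpecIso (CommRingCat.of k)).inv.hom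
  have hσ : Function.Surjective σ := (Scheme.ΓSpecIso (CommRingCat.of k)).commRingCatIsoToRingEquiv.symm.surjective
  have hf : ∀ (c : k) (x : Ext.{1} (unitModule V.left) (unitModule V.left) (n + 1)), f (c • x) = σ c • f x := by
    intro c x
    -- `c • x = x ∘ [c • 𝟙]`, carried by Leray to `Hⁿ⁺¹(Č•_ord(𝔚, c • 𝟙))`
    let φ : unitModule V.left ⟶ unitModule V.left := c • 𝟙 (unitModule V.left)
    let ψ : K ⟶ K := AcyclicResolution.extComplexMap (unitModule V.left) (CechOrd.mapComplex 𝔚.W φ)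
    have h1 : E (c • x) = (HomologicalComplex.homologyMap ψ (n + 1)).hom (E x) := by
      rw [Ext.smul_eq_comp_mk₀]
      exact (CechOrd.extUnitAddEquivHomologySucc_naturality 𝔚.W φ hU hcov hM hM n x).symm
    -- on cochains `ψ` is multiplication by the rational function of `c`, i.e. by `σ c`
    have hψ : ∀ (m : ℕ) (y : K.X m), e m ((ψ.f m).hom y) = σ c • e m y := by
      intro m y
      change 𝔚.sectionsAddEquiv m (CechOrd.homTopAddEquiv 𝔚.W (unitModule V.left) m
        (((AcyclicResolution.extComplexMap (unitModule V.left) (CechOrd.mapComplex 𝔚.W φ)).f m).hom y)) =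
        σ c • 𝔚.sectionsAddEquiv m (CechOrd.homTopAddEquiv 𝔚.W (unitModule V.left) m y)
      funext τ
      apply Subtype.ext
      rw [𝔚.sectionsAddEquiv_apply, 𝔚.sectionsAddEquiv_apply, 𝔚.coe_toCochain_apply]
      rw [CechOrd.homTopAddEquiv_map]
      change 𝔚.toK (𝔚.idxOf τ) ((c • 𝟙 (unitModule V.left)).app _
        (CechOrd.homTopAddEquiv 𝔚.W (unitModule V.left) m y (𝔚.idxOf τ))) = _
      rw [base_smul_app_apply, Scheme.Modules.Hom.id_app]
      change 𝔚.toK (𝔚.idxOf τ) (Cech.resO (X := V.left) (inf_le_left) (scalarRingHomTop V c) • _) = _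
      rw [𝔚.toK_smul_top]
      change _ = ((σ c • 𝔚.toCochain m (CechOrd.homTopAddEquiv 𝔚.W (unitModule V.left) m y) τ :
        𝔚.sectionsOn τ.1) : V.left.functionField)
      rw [Submodule.coe_smul, Algebra.smul_def, CartierDivisor.baseAlgebra_algebraMap, 𝔚.coe_toCochain_apply]
      rfl
    have h2 := HomologyTransfer.homologyAddEquiv_homologyMap_of_smul e he hψ n (E x)
    change T (E (c • x)) = σ c • T (E x)
    rw [h1, h2]
  exact Module.Finite.of_addEquiv_semilinear σ hσ f hf

/-- **`Extⁿ(𝒪_V, 𝒪_V)` is finite over `k` for every `V → Spec k` proper with `V` integral and every `n`**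
(degree `0` by `Ext⁰ ↪ Γ(V, 𝒪_V)` and the finiteness of global sections of coherent modules on proper
schemes; positive degrees by `module_finite_ext_unit_unit_succ_of_isIntegral`).
[cite: GortzWedhorn2023, Thm. 23.17 with proof and Cor. 23.18 (pp. 424–425)] -/
theorem module_finite_ext_unit_unit_of_isIntegral (n : ℕ) :
    Module.Finite k (Ext.{1} (unitModule V.left) (unitModule V.left) n) := by
  cases n with
  | zero =>
    exact module_finite_ext_unit_zero.{1} V (unitModule V.left)
      (coh_of_isVectorBundle isFiniteLocallyFree_unitModule.isVectorBundle)
  | succ n => exact module_finite_ext_unit_unit_succ_of_isIntegral k V n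

end Integral

/-- **Görtz–Wedhorn II, Cor. 23.18 (field case) — the named fact
`GortzWedhorn2023_cohomology_proper_coherent_finite` HOLDS**: for every field `k`, every proper
`X → Spec k`, every coherent `𝒪_X`-module `𝓕` and every `n`, the `k`-vector space
`Hom_{D(Mod 𝒪_X)}(Q 𝒪_X[0], (Q 𝓕[0])⟦n⟧) = Hⁿ(X, 𝓕)` is finite-dimensional.  Proof:
`GortzWedhorn2023_cohomology_proper_coherent_finite_of_integral_ext` (dévissage to `𝓕 = 𝒪_V`, `V`
integral) and `module_finite_ext_unit_unit_of_isIntegral`.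
[cite: GortzWedhorn2023, Thm. 23.17 with proof and Cor. 23.18 (pp. 424–425)] [cite: GortzWedhorn2020, Lemma 12.63 (p. 436)] -/
theorem GortzWedhorn2023_cohomology_proper_coherent_finite_holds :
    GortzWedhorn2023_cohomology_proper_coherent_finite :=
  GortzWedhorn2023_cohomology_proper_coherent_finite_of_integral_ext
    fun k _ V _ _ n => module_finite_ext_unit_unit_of_isIntegral k V n

end Literature.AlgebraicGeometry.Morphisms

end
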